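import Literature.Probability.RandomPlanarGeometry.SLERestrictionLocal
import Literature.Probability.RandomPlanarGeometry.SLERestrictionMartingaleExists
import Literature.Probability.RandomPlanarGeometry.RohdeSchrammCor35Proofs
import HarnessLib

/-!
# [LSW] Theorem 6.1 (restriction formula for SLE_{8/3}): the discharge

This file discharges the named fact
`Literature.Probability.RandomPlanarGeometry.sle_restriction_eightThirds` (`RestrictionHulls`):

* G. F. Lawler, O. Schramm, W. Werner, *Conformal restriction: the chordal case*, J. Amer. Math.
  Soc. **16** (2003) 917–955, arXiv:math/0209343 (**[LSW]**), Thm. 6.1 (Restriction), p. 23: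
  "Let `γ` be the SLE_{8/3} path starting at the origin and `A ∈ 𝒬*`, then
  `P[γ[0,∞) ∩ A = ∅] = Φ_A'(0)^{5/8}`."

The printed proof (§6, the paragraph after Lemma 6.3): "By Proposition 3.3, it suffices to
consider the case where `A` is a smooth hull in `𝒬₊ ∪ 𝒬₋`. By symmetry, we may take `A ∈ 𝒬₊`.
Proposition 5.2 shows that `Y_t = h_t'(W_t)^{5/8}` is a bounded continuous local martingale. By
the martingale convergence theorem, the a.s. limit `Y_T` exists and `Y_0 = E[Y_T]`. Lemmas 6.2
and 6.3 show that `Y_T = 1_{T = ∞}` a.s." Its assembly in the tree is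
`Literature.Probability.RandomPlanarGeometry.sle_restriction_eightThirds_of_hasSLETrace`
(`SLERestrictionLocal`: Lemmas 6.2/6.3 along the SLE_{8/3} flow, the two-sided and smooth
reductions of Prop. 3.3, and the martingale deduction
`IsRestrictionMartingale.measure_disjoint_eq`), which takes the two deep inputs of that paragraph
as hypotheses. Both are now theorems of the tree:

1. `HasSLETrace (8/3)` — the SLE_{8/3} chain is almost surely generated by a curve (Rohde–Schramm
   2005, Thm. 5.1 for `κ ≠ 8`, from their Thm. 3.6 / Cor. 3.5):
   `Literature.Probability.RandomPlanarGeometry.hasSLETrace_of_ne_eight_holds`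
   (`RohdeSchrammCor35Proofs`);
2. `sle_exists_isRestrictionMartingale` — [LSW] Prop. 5.2/5.3 at `κ = 8/3` (the bounded
   martingale `h_t'(W_t)^{5/8}` with its terminal limit), proved Itô-free by conditional
   increments and transported from the hull hitting time to the trace hitting time with the
   Rohde–Schramm trace facts (Thm. 5.1, and Thm. 6.1: simplicity for `κ ≤ 4`, itself a theorem
   given Thm. 5.1, `ae_isSimpleTrace_sleTrace_of_le_four_of_hasSLETrace_fact`):
   `Literature.Probability.RandomPlanarGeometry.sle_exists_isRestrictionMartingale_of_trace_facts`
   (`SLERestrictionMartingaleExists`).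

No new definition, no new named fact; axioms `propext`, `Classical.choice`, `Quot.sound`.

## References

* [LSW] G. F. Lawler, O. Schramm, W. Werner, *Conformal restriction: the chordal case*, J. Amer.
  Math. Soc. 16 (2003) 917–955, Thm. 6.1 (p. 23); Prop. 5.2, Prop. 5.3 (§5); Lemmas 6.2, 6.3
  (§6); Prop. 3.3 (§3). [LawlerSchrammWerner2003Restriction]
* S. Rohde, O. Schramm, *Basic properties of SLE*, Ann. of Math. 161 (2005) 883–924, Thm. 3.6,
  Thm. 5.1, Thm. 6.1. [RohdeSchramm2005]
-/

open scoped NNReal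

namespace Literature.Probability.RandomPlanarGeometry

/-- `8/3 ≠ 8` in `ℝ≥0` (the SLE parameter of [LSW] Thm. 6.1 is in the range of Rohde–Schramm's
Thm. 5.1). [folklore] -/
theorem eightThirds_ne_eight : ((8 : ℝ≥0) / 3) ≠ 8 := by
  rw [Ne, div_eq_iff (by norm_num)]; norm_num

/-- **SLE_{8/3} is generated by a curve** (Rohde–Schramm Thm. 5.1 at `κ = 8/3`), the first input
of the proof of [LSW] Thm. 6.1 ("we know [RS] that SLE_{8/3} is a simple curve").
[cite: RohdeSchramm2005, Thm 5.1] -/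
theorem hasSLETrace_eightThirds : HasSLETrace ((8 : ℝ≥0) / 3) :=
  hasSLETrace_of_ne_eight_holds eightThirds_ne_eight

/-- **[LSW] Theorem 6.1 (Restriction)**
(`Literature.Probability.RandomPlanarGeometry.sle_restriction_eightThirds` holds): for the
SLE_{8/3} trace `γ` from `0` in `ℍ` and every `A ∈ 𝒬*` with restriction map `Φ_A` and
`Φ_A'(0) = d`, `P[γ[0,∞) ∩ A = ∅] = d^{5/8}`. Assembled from the tree's proof of the §6
paragraph (`sle_restriction_eightThirds_of_hasSLETrace`) fed with Rohde–Schramm's Thm. 5.1 at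
`κ = 8/3` and [LSW] Prop. 5.2/5.3 (`sle_exists_isRestrictionMartingale_of_trace_facts`).
[cite: LawlerSchrammWerner2003Restriction, Thm. 6.1 (p. 23)] -/
theorem sle_restriction_eightThirds_holds : sle_restriction_eightThirds :=
  sle_restriction_eightThirds_of_hasSLETrace hasSLETrace_eightThirds
    (sle_exists_isRestrictionMartingale_of_trace_facts hasSLETrace_of_ne_eight_holds
      (ae_isSimpleTrace_sleTrace_of_le_four_of_hasSLETrace_fact hasSLETrace_of_ne_eight_holds))

end Literature.Probability.RandomPlanarGeometry
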